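import Summits.BirchSwinnertonDyer.BirchSwinnertonDyer.Theorems.Rank2Observatory2DescKillConic

/-!
# BirchSwinnertonDyer — rank ≥ 2 observatory: KERNEL-2DESC kill layer (QK), the conic-obstruction
# certificate (ternary residue tree)

HONEST FRAMING: per-curve certified theorems and census instruments; no claim on BSD in rank ≥ 2.

Generic file of the KERNEL-2DESC-CL "QK" kill layer (cert-1 gen 26), third part. When the conic
`C = c₁q₁ + c₂q₂` (`c₁t₁ + c₂t₂ = 0`, `Rank2Observatory2DescKillConic`) of a class has NO
`p`-adic point, the class is dead at `p` without any quartic: every zero `(r, n)` of `killQ` has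
`C(r) = 0` and `r ≠ 0` (as `t₁ ≠ 0`), and dividing `r` by the gcd of its coordinates gives a zero
of `C` primitive at `p`. This file certifies the absence of such zeros by a residue tree on the
conic alone, written on its six COEFFICIENTS `cqCoef` divided by their content `e` (certificate
`κ` with `cqCoef = e·κ`, checked by `decide`; `cq_ternEval : C(X) = ternEval (cqCoef …) X`) — three
projective charts (`w ≡ 1`, `y ≡ 1 ∧ p ∣ w`, `x ≡ 1 ∧ p ∣ y ∧ p ∣ w`), two free digits per level
(`p²` children), a node at precision `p^k` being DEAD when `κ(X) ≢ 0 (mod p^k)`: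

* `ternEval`, `cqCoef`, `cq_ternEval` — the coefficient form of the conic (a ring identity);
* `cnode`, `conicCheck` — the fuelled tree (pure structural recursion, `decide +kernel`);
* `conicCheck_sound` — `conicCheck p κ fuel = true ⇒ κ` has no integer zero primitive at `p`;
* `conicCert_sound` — with `c₁t₁ + c₂t₂ = 0 ∧ t₁ ≠ 0 ∧ e ≠ 0 ∧ cqCoef = e·κ` (`conicCertCheck`),
  `killQ` has no integer zero primitive at `p`: literally the statement consumed by the row layers
  (`KillValidAt`).

Elementary (congruences, gcd of three integers); no `p`-adic numbers. References: J. W. S. Cassels,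
*Lectures on Elliptic Curves* (1991), §15; J. E. Cremona, *Algorithms for Modular Elliptic Curves*
(1997), §3.6. [cite: Cassels1991LecturesEllipticCurves, §15]
-/

set_option linter.dupNamespace false

namespace Summit.BirchSwinnertonDyer.BirchSwinnertonDyer.Rank2Observatory.TwoDescKill

/-! ### The coefficient form of the conic -/

section Ring

variable {R : Type*} [CommRing R]

/-- The ternary quadratic form with coefficient sextuple `κ = (κ₁₁, κ₂₂, κ₃₃, κ₁₂, κ₁₃, κ₂₃)`:
`κ₁₁x² + κ₂₂y² + κ₃₃w² + κ₁₂xy + κ₁₃xw + κ₂₃yw`. [folklore] -/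
def ternEval (κ : R × R × R × R × R × R) (X : R × R × R) : R :=
  κ.1 * X.1 * X.1 + κ.2.1 * X.2.1 * X.2.1 + κ.2.2.1 * X.2.2 * X.2.2 + κ.2.2.2.1 * X.1 * X.2.1 +
    κ.2.2.2.2.1 * X.1 * X.2.2 + κ.2.2.2.2.2 * X.2.1 * X.2.2

/-- The six coefficients of the conic `c₁q₁ + c₂q₂` (values at the unit vectors, polar values at
pairs of unit vectors). [folklore] -/
def cqCoef (a b c : R) (z : R × R × R) (c₁ c₂ : R) : R × R × R × R × R × R :=
  (cq a b c z c₁ c₂ (1, 0, 0), cq a b c z c₁ c₂ (0, 1, 0), cq a b c z c₁ c₂ (0, 0, 1),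
    bq a b c z c₁ c₂ (1, 0, 0) (0, 1, 0), bq a b c z c₁ c₂ (1, 0, 0) (0, 0, 1),
    bq a b c z c₁ c₂ (0, 1, 0) (0, 0, 1))

/-- **The conic in coefficient form**: `C(X) = ternEval (cqCoef …) X`. [folklore] -/
theorem cq_ternEval (a b c : R) (z : R × R × R) (c₁ c₂ : R) (X : R × R × R) :
    cq a b c z c₁ c₂ X = ternEval (cqCoef a b c z c₁ c₂) X := by
  obtain ⟨x, y, w⟩ := X
  simp only [cqCoef, ternEval, cq, bq, hq, lz, mul3]
  ring

/-- `ternEval` is homogeneous of degree `2`. [folklore] -/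
theorem ternEval_smul (κ : R × R × R × R × R × R) (l x y w : R) :
    ternEval κ (l * x, l * y, l * w) = l ^ 2 * ternEval κ (x, y, w) := by
  simp only [ternEval]; ring

/-- `e·κ`, componentwise. [folklore] -/
def smul6 (e : R) (κ : R × R × R × R × R × R) : R × R × R × R × R × R :=
  (e * κ.1, e * κ.2.1, e * κ.2.2.1, e * κ.2.2.2.1, e * κ.2.2.2.2.1, e * κ.2.2.2.2.2)

/-- `ternEval (e·κ) X = e · ternEval κ X`. [folklore] -/
theorem ternEval_smul6 (e : R) (κ : R × R × R × R × R × R) (X : R × R × R) :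
    ternEval (smul6 e κ) X = e * ternEval κ X := by
  simp only [ternEval, smul6]; ring

end Ring

/-! ### The tree -/

/-- The representative point of a node: chart `0 ↦ (s, t, 1)`, `1 ↦ (s, 1, t)`, `2 ↦ (1, s, t)`.
[folklore] -/
def cpt (ch : ℕ) (s t : ℤ) : ℤ × ℤ × ℤ :=
  if ch = 0 then (s, t, 1) else if ch = 1 then (s, 1, t) else (1, s, t)

/-- First free coordinate of a point in chart `ch`. [folklore] -/
def cfree1 (ch : ℕ) (X : ℤ × ℤ × ℤ) : ℤ := if ch = 0 then X.1 else if ch = 1 then X.1 else X.2.1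

/-- Second free coordinate of a point in chart `ch`. [folklore] -/
def cfree2 (ch : ℕ) (X : ℤ × ℤ × ℤ) : ℤ := if ch = 0 then X.2.1 else X.2.2

/-- The normalised coordinate of a point in chart `ch`. [folklore] -/
def cfix (ch : ℕ) (X : ℤ × ℤ × ℤ) : ℤ := if ch = 0 then X.2.2 else if ch = 1 then X.2.1 else X.1

/-- A node at precision `p^k` is DEAD when `κ(X) ≢ 0 (mod p^k)` there. [folklore] -/
def cdead (p : ℕ) (N : ℤ) (k : ℕ) : Bool := !decide (N % ((p ^ k : ℕ) : ℤ) = 0)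

/-- The fuelled search below the node `(s, t)` (free coordinates mod `p^k`) of chart `ch`: dead, or
all `p²` children certified. [cite: CremonaAlgorithms1997, §3.6] -/
def cnode (p : ℕ) (κ : ℤ × ℤ × ℤ × ℤ × ℤ × ℤ) (ch : ℕ) : ℕ → ℤ → ℤ → ℕ → Bool
  | 0, s, t, k => cdead p (ternEval κ (cpt ch s t)) k
  | f + 1, s, t, k => cdead p (ternEval κ (cpt ch s t)) k ||
      (List.range p).all fun d₁ => (List.range p).all fun d₂ =>
        cnode p κ ch f (s + (p : ℤ) ^ k * (d₁ : ℤ)) (t + (p : ℤ) ^ k * (d₂ : ℤ)) (k + 1)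

/-- **The conic-obstruction certificate**: every chart-normalised residue point mod `p` is certified
by `cnode`. [cite: CremonaAlgorithms1997, §3.6] -/
def conicCheck (p : ℕ) (κ : ℤ × ℤ × ℤ × ℤ × ℤ × ℤ) (fuel : ℕ) : Bool :=
  ((List.range p).all fun d₁ => (List.range p).all fun d₂ => cnode p κ 0 fuel (d₁ : ℤ) (d₂ : ℤ) 1) &&
    ((List.range p).all fun d₁ => cnode p κ 1 fuel (d₁ : ℤ) 0 1) &&
    cnode p κ 2 fuel 0 0 1

/-- Side conditions of a conic-obstruction kill: `c₁t₁ + c₂t₂ = 0`, `t₁ ≠ 0`, `e ≠ 0` and the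
coefficient identity `cqCoef = e·κ`. [folklore] -/
def conicCertCheck (a b c : ℤ) (z : ℤ × ℤ × ℤ) (t₁ t₂ c₁ c₂ e : ℤ) (κ : ℤ × ℤ × ℤ × ℤ × ℤ × ℤ) :
    Bool :=
  decide (c₁ * t₁ + c₂ * t₂ = 0) && decide (t₁ ≠ 0) && decide (e ≠ 0) &&
    decide (cqCoef a b c z c₁ c₂ = smul6 e κ)

/-! ### Soundness -/

/-- Componentwise congruent points have congruent `ternEval`-values. [folklore] -/
theorem ternEval_congr (κ : ℤ × ℤ × ℤ × ℤ × ℤ × ℤ) (n : ℕ) (X X' : ℤ × ℤ × ℤ)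
    (h1 : (n : ℤ) ∣ X'.1 - X.1) (h2 : (n : ℤ) ∣ X'.2.1 - X.2.1) (h3 : (n : ℤ) ∣ X'.2.2 - X.2.2) :
    (n : ℤ) ∣ ternEval κ X' - ternEval κ X := by
  obtain ⟨x, y, w⟩ := X
  obtain ⟨x', y', w'⟩ := X'
  simp only at h1 h2 h3
  have e1 := (ZMod.intCast_eq_intCast_iff_dvd_sub x x' n).mpr h1
  have e2 := (ZMod.intCast_eq_intCast_iff_dvd_sub y y' n).mpr h2
  have e3 := (ZMod.intCast_eq_intCast_iff_dvd_sub w w' n).mpr h3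
  apply (ZMod.intCast_eq_intCast_iff_dvd_sub _ _ n).mp
  simp only [ternEval]
  push_cast
  rw [e1, e2, e3]

/-- Chart bookkeeping: the congruences on the free / normalised coordinates are the componentwise
congruences to the node's representative point. [folklore] -/
theorem cpt_congr (ch : ℕ) (X : ℤ × ℤ × ℤ) (s t M : ℤ) (h1 : M ∣ cfree1 ch X - s)
    (h2 : M ∣ cfree2 ch X - t) (h3 : M ∣ cfix ch X - 1) :
    M ∣ X.1 - (cpt ch s t).1 ∧ M ∣ X.2.1 - (cpt ch s t).2.1 ∧ M ∣ X.2.2 - (cpt ch s t).2.2 := by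
  by_cases h0 : ch = 0
  · subst h0; simp only [cfree1, cfree2, cfix, cpt, if_true] at h1 h2 h3 ⊢; exact ⟨h1, h2, h3⟩
  by_cases h1' : ch = 1
  · subst h1'; simp only [cfree1, cfree2, cfix, cpt, if_true, if_false, one_ne_zero] at h1 h2 h3 ⊢
    exact ⟨h1, h3, h2⟩
  · simp only [cfree1, cfree2, cfix, cpt, h0, h1', if_false] at h1 h2 h3 ⊢; exact ⟨h3, h1, h2⟩

/-- **Dead nodes are sound**. [folklore] -/
theorem cdead_sound {p : ℕ} {N : ℤ} {k : ℕ} (hd : cdead p N k = true)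
    (h : ((p ^ k : ℕ) : ℤ) ∣ N) : False := by
  simp only [cdead, Bool.not_eq_true', decide_eq_false_iff_not] at hd
  exact hd (Int.emod_eq_zero_of_dvd h)

/-- **Node soundness**: if `cnode p κ ch f s t k = true` then no point `X` of chart `ch` congruent to
the node (free coordinates `≡ (s, t) (mod p^k)`, normalised coordinate `≡ 1 (mod p^(k+f))`) is a
zero of `κ`. [cite: CremonaAlgorithms1997, §3.6] -/
theorem cnode_sound {p : ℕ} (hp : p.Prime) (κ : ℤ × ℤ × ℤ × ℤ × ℤ × ℤ) (ch : ℕ) :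
    ∀ (f : ℕ) (s t : ℤ) (k : ℕ), cnode p κ ch f s t k = true → ∀ X : ℤ × ℤ × ℤ,
      ((p ^ k : ℕ) : ℤ) ∣ cfree1 ch X - s → ((p ^ k : ℕ) : ℤ) ∣ cfree2 ch X - t →
      ((p ^ (k + f) : ℕ) : ℤ) ∣ cfix ch X - 1 → ternEval κ X ≠ 0 := by
  intro f
  induction f with
  | zero =>
      intro s t k h X h1 h2 h3 hX
      simp only [cnode] at h
      obtain ⟨e1, e2, e3⟩ := cpt_congr ch X s t _ h1 h2 (by simpa using h3)
      have hc := ternEval_congr κ (p ^ k) (cpt ch s t) X e1 e2 e3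
      rw [hX, zero_sub, dvd_neg] at hc
      exact cdead_sound h hc
  | succ f ih =>
      intro s t k h X h1 h2 h3 hX
      simp only [cnode, Bool.or_eq_true, List.all_eq_true, List.mem_range] at h
      have hpk : ((p ^ k : ℕ) : ℤ) ∣ ((p ^ (k + (f + 1)) : ℕ) : ℤ) :=
        Int.natCast_dvd_natCast.mpr (pow_dvd_pow p (by omega))
      rcases h with hd | hall
      · obtain ⟨e1, e2, e3⟩ := cpt_congr ch X s t _ h1 h2 (hpk.trans h3)
        have hc := ternEval_congr κ (p ^ k) (cpt ch s t) X e1 e2 e3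
        rw [hX, zero_sub, dvd_neg] at hc
        exact cdead_sound hd hc
      · have hkf : k + 1 + f = k + (f + 1) := by ring
        obtain ⟨d₁, hd₁, g₁⟩ := exists_digit hp.pos (p ^ k) h1
        obtain ⟨d₂, hd₂, g₂⟩ := exists_digit hp.pos (p ^ k) h2
        have g₁' : ((p ^ (k + 1) : ℕ) : ℤ) ∣ cfree1 ch X - (s + (p : ℤ) ^ k * (d₁ : ℤ)) := by
          push_cast at g₁ ⊢; rw [pow_succ]; exact g₁
        have g₂' : ((p ^ (k + 1) : ℕ) : ℤ) ∣ cfree2 ch X - (t + (p : ℤ) ^ k * (d₂ : ℤ)) := by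
          push_cast at g₂ ⊢; rw [pow_succ]; exact g₂
        exact ih _ _ (k + 1) (hall d₁ hd₁ d₂ hd₂) X g₁' g₂' (by rw [hkf]; exact h3) hX

/-- **Soundness of the conic-obstruction certificate**: if `conicCheck p … fuel = true` for a prime
`p`, then `κ` has no integer zero `(x, y, w)` with `p ∤ (x, y, w)`.
[cite: CremonaAlgorithms1997, §3.6] -/
theorem conicCheck_sound {p : ℕ} (hp : p.Prime) {κ : ℤ × ℤ × ℤ × ℤ × ℤ × ℤ} {fuel : ℕ}
    (h : conicCheck p κ fuel = true) (x y w : ℤ)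
    (hprim : ¬ ((p : ℤ) ∣ x ∧ (p : ℤ) ∣ y ∧ (p : ℤ) ∣ w)) (h0 : ternEval κ (x, y, w) = 0) :
    False := by
  have hp0 : 0 < p := hp.pos
  have hpZ : Prime (p : ℤ) := Nat.prime_iff_prime_int.mp hp
  simp only [conicCheck, Bool.and_eq_true, List.all_eq_true, List.mem_range] at h
  obtain ⟨⟨hc0, hc1⟩, hc2⟩ := h
  have unit_of : ∀ r : ℤ, ¬ (p : ℤ) ∣ r → ∃ l e : ℤ, l * r + e * (p : ℤ) ^ (1 + fuel) = 1 := by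
    intro r hr
    have hcop : IsCoprime r ((p : ℤ) ^ (1 + fuel)) :=
      ((Prime.coprime_iff_not_dvd hpZ).mpr hr).symm.pow_right
    obtain ⟨l, e, hle⟩ := hcop
    exact ⟨l, e, hle⟩
  have digit : ∀ r : ℤ, ∃ d : ℕ, d < p ∧ (p : ℤ) ∣ r - d := by
    intro r
    have hp' : (0 : ℤ) < p := by exact_mod_cast hp0
    refine ⟨(r % (p : ℤ)).toNat, ?_, r / p, ?_⟩
    · have := Int.emod_lt_of_pos r hp'; have := Int.emod_nonneg r hp'.ne'; omega
    · rw [Int.toNat_of_nonneg (Int.emod_nonneg r hp'.ne')]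
      linear_combination (-1 : ℤ) * Int.emod_add_ediv_mul r (p : ℤ)
  have scaled : ∀ l : ℤ, ternEval κ (l * x, l * y, l * w) = 0 := by
    intro l; rw [ternEval_smul, h0, mul_zero]
  have fix1 : ∀ l e r : ℤ, l * r + e * (p : ℤ) ^ (1 + fuel) = 1 →
      ((p ^ (1 + fuel) : ℕ) : ℤ) ∣ l * r - 1 := by
    intro l e r hle; push_cast; exact ⟨-e, by linear_combination hle⟩
  by_cases hw : (p : ℤ) ∣ w
  · by_cases hy : (p : ℤ) ∣ y
    · -- chart 2: `p ∣ y`, `p ∣ w`, so `p ∤ x`; scale `x` to `1`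
      have hx : ¬ (p : ℤ) ∣ x := fun hx => hprim ⟨hx, hy, hw⟩
      obtain ⟨l, e, hle⟩ := unit_of x hx
      refine cnode_sound hp κ 2 fuel 0 0 1 hc2 (l * x, l * y, l * w) ?_ ?_ ?_ (scaled l)
      · simpa [cfree1] using dvd_mul_of_dvd_right hy l
      · simpa [cfree2] using dvd_mul_of_dvd_right hw l
      · simpa [cfix] using fix1 l e x hle
    · -- chart 1: `p ∣ w`, `p ∤ y`; scale `y` to `1`, first digit of `l x`
      obtain ⟨l, e, hle⟩ := unit_of y hy
      obtain ⟨d, hd, g⟩ := digit (l * x)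
      refine cnode_sound hp κ 1 fuel (d : ℤ) 0 1 (hc1 d hd) (l * x, l * y, l * w)
        ?_ ?_ ?_ (scaled l)
      · simpa [cfree1] using g
      · simpa [cfree2] using dvd_mul_of_dvd_right hw l
      · simpa [cfix] using fix1 l e y hle
  · -- chart 0: `p ∤ w`; scale `w` to `1`, first digits of `l x`, `l y`
    obtain ⟨l, e, hle⟩ := unit_of w hw
    obtain ⟨d₁, hd₁, g₁⟩ := digit (l * x)
    obtain ⟨d₂, hd₂, g₂⟩ := digit (l * y)
    refine cnode_sound hp κ 0 fuel (d₁ : ℤ) (d₂ : ℤ) 1 (hc0 d₁ hd₁ d₂ hd₂)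
      (l * x, l * y, l * w) ?_ ?_ ?_ (scaled l)
    · simpa [cfree1] using g₁
    · simpa [cfree2] using g₂
    · simpa [cfix] using fix1 l e w hle

/-- **Soundness of a conic-obstruction kill**: with `conicCertCheck … = true` (`c₁t₁ + c₂t₂ = 0`,
`t₁ ≠ 0`, `e ≠ 0`, `cqCoef = e·κ`) and `conicCheck p κ fuel = true`, `killQ` has no integer zero
primitive at `p` — the statement of `killCheck_sound`, consumed unchanged by the row layers
(`KillValidAt`). [cite: Cassels1991LecturesEllipticCurves, §15] -/
theorem conicCert_sound {p : ℕ} (hp : p.Prime) {a b c : ℤ} {z : ℤ × ℤ × ℤ} {t₁ t₂ c₁ c₂ e : ℤ}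
    {κ : ℤ × ℤ × ℤ × ℤ × ℤ × ℤ} {fuel : ℕ} (hc : conicCertCheck a b c z t₁ t₂ c₁ c₂ e κ = true)
    (hk : conicCheck p κ fuel = true) (v : ℤ × ℤ × ℤ × ℤ)
    (hprim : ¬ ((p : ℤ) ∣ v.1 ∧ (p : ℤ) ∣ v.2.1 ∧ (p : ℤ) ∣ v.2.2.1 ∧ (p : ℤ) ∣ v.2.2.2))
    (h0 : killQ a b c z t₁ t₂ v = 0) : False := by
  obtain ⟨r₀, r₁, r₂, n⟩ := v
  dsimp only at hprim
  simp only [conicCertCheck, Bool.and_eq_true, decide_eq_true_eq] at hc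
  obtain ⟨⟨⟨hct, ht⟩, he⟩, hκ⟩ := hc
  -- `κ(r) = 0`
  have hcr : ternEval κ (r₀, r₁, r₂) = 0 := by
    have h1 : cq a b c z c₁ c₂ (r₀, r₁, r₂) = 0 := by
      rw [cq_killQ a b c z c₁ c₂ t₁ t₂ r₀ r₁ r₂ n h0, hct]; ring
    rw [cq_ternEval, hκ, ternEval_smul6] at h1
    exact (mul_eq_zero.mp h1).resolve_left he
  -- `r ≠ 0`
  have hr0 : ¬ (r₀ = 0 ∧ r₁ = 0 ∧ r₂ = 0) := by
    rintro ⟨e0, e1, e2⟩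
    subst e0 e1 e2
    have h1 : t₁ * n ^ 2 = 0 := by
      have := congrArg Prod.fst h0
      simpa [killQ, zsq, mul3] using this
    have hn : n = 0 := by
      rcases mul_eq_zero.mp h1 with h | h
      · exact absurd h ht
      · exact pow_eq_zero_iff (n := 2) (by norm_num) |>.mp h
    subst hn
    exact hprim ⟨dvd_zero _, dvd_zero _, dvd_zero _, dvd_zero _⟩
  -- divide by the gcd of the coordinates
  obtain ⟨g, hg⟩ : ∃ g : ℕ, Int.gcd (Int.gcd r₀ r₁ : ℤ) r₂ = g := ⟨_, rfl⟩
  have hg0 : 0 < g := by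
    rw [← hg]; apply Nat.pos_of_ne_zero; intro h
    rw [Int.gcd_eq_zero_iff] at h
    obtain ⟨h01, h2⟩ := h
    have h01' : Int.gcd r₀ r₁ = 0 := by exact_mod_cast h01
    rw [Int.gcd_eq_zero_iff] at h01'
    exact hr0 ⟨h01'.1, h01'.2, h2⟩
  have hg01 : (g : ℤ) ∣ (Int.gcd r₀ r₁ : ℤ) := hg ▸ Int.gcd_dvd_left _ _
  have d0 : (g : ℤ) ∣ r₀ := hg01.trans (Int.gcd_dvd_left _ _)
  have d1 : (g : ℤ) ∣ r₁ := hg01.trans (Int.gcd_dvd_right _ _)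
  have d2 : (g : ℤ) ∣ r₂ := hg ▸ Int.gcd_dvd_right _ _
  obtain ⟨x, hx⟩ := d0
  obtain ⟨y, hy⟩ := d1
  obtain ⟨w, hw⟩ := d2
  have hgZ : (g : ℤ) ≠ 0 := by exact_mod_cast hg0.ne'
  -- the quotient point is a zero of `κ` …
  have hq0 : ternEval κ (x, y, w) = 0 := by
    have := hcr
    rw [hx, hy, hw, ternEval_smul] at this
    exact (mul_eq_zero.mp this).resolve_left (pow_ne_zero 2 hgZ)
  -- … and primitive at `p`
  have hprim' : ¬ ((p : ℤ) ∣ x ∧ (p : ℤ) ∣ y ∧ (p : ℤ) ∣ w) := by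
    rintro ⟨⟨x', ex⟩, ⟨y', ey⟩, ⟨w', ew⟩⟩
    have e0 : ((p * g : ℕ) : ℤ) ∣ r₀ := ⟨x', by rw [hx, ex]; push_cast; ring⟩
    have e1 : ((p * g : ℕ) : ℤ) ∣ r₁ := ⟨y', by rw [hy, ey]; push_cast; ring⟩
    have e2 : ((p * g : ℕ) : ℤ) ∣ r₂ := ⟨w', by rw [hw, ew]; push_cast; ring⟩
    have h01 : p * g ∣ Int.gcd r₀ r₁ := Int.dvd_gcd e0 e1
    have hdg : p * g ∣ Int.gcd (Int.gcd r₀ r₁ : ℤ) r₂ :=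
      Int.dvd_gcd (Int.natCast_dvd_natCast.mpr h01) e2
    rw [hg] at hdg
    have hle := Nat.le_of_dvd hg0 hdg
    have hp2 := hp.two_le
    nlinarith
  exact conicCheck_sound hp hk x y w hprim' hq0

end Summit.BirchSwinnertonDyer.BirchSwinnertonDyer.Rank2Observatory.TwoDescKill
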